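import Mathlib
import Literature.MathematicalPhysics.QuantumLattice.HubbardBandShellVolume
import Literature.MathematicalPhysics.QuantumLattice.HubbardBandSectorCountingToolbox
import Summits.HubbardSuperconductivity.HubbardSuperconductivity.Theorems.KLProgrammeKLRegimeTwoPointLimitShellCountCaustic
import HarnessLib

/-!
# Route `KLProgramme` — crux K3 `KLRegimeTwoPointLimit` (stmt-HubbardSuperconductivity-19937), support:
# the general tube reduction of a constrained energy shell, and the Cooper region of the shell
# (DECOMP App. E Lemma E.1 method; App. D U5′ "Cooper region of relative measure `γ^{k̄}` on the shell")

Cell `gate-hubbard-kl`, seat p1b; paper note `HOME/prover-p1b/E1-NOTE.md` §3 Lemma 3 (method) and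
DECOMP App. D, U5′. The polar-coordinate tube reduction behind `klta_volume_twoShell_le` is stated here
for an ARBITRARY constraint `A ⊆ ℝ²` on the shell momentum (`klsb_volume_shell_inter_le`): the planar
measure of `{k ∈ [-π,π)² : |ε(k) - μ| < ε₁} ∩ A` is at most `16 L ε₁` times the measure of any
measurable set of angles `Θ` containing every `θ ∈ (-π, π)` for which some point `(r cos θ, r sin θ)`
of the radial window `u_{μ-ε₁}(θ) < r < u_{μ+ε₁}(θ)` lies in `A`. Instance (`klsb_volume_shellBall_le`
with `klsb_volume_angularBall_le`): the COOPER REGION `{|ε(k) - μ| < ε₁, |k + p|_∞ ≤ ρ}` of the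
shell (the support of the large momentum-derivatives of the frozen ladder kernel `V(k + p)` in the
tadpole-contracted vertex, DECOMP App. D U5′) has measure `≤ 16 L ε₁ · 12π(ρ + Lε₁)/(√2 u_min)` —
relative measure `O(ρ + ε₁)` on the shell, uniformly in `p`.
-/

noncomputable section

-- the tree's namespace `Summit.<Summit>.<Problem>.Theorems` repeats the summit name by design (D-0017)
set_option linter.dupNamespace false

open Real Set MeasureTheory
open scoped ENNReal
open Literature.MathematicalPhysics.QuantumLattice
open Literature.MathematicalPhysics.QuantumLattice.BandSectorCounting

namespace Summit.HubbardSuperconductivity.HubbardSuperconductivity.Theorems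

/-- **General tube reduction of a constrained shell.** For a compact sub-band `[a', b'] ⊂ (-4, 0)`
there is `L ≥ 0` such that for all `μ` with `μ ± ε₁ ∈ [a', b']`, `0 < ε₁`, every measurable
planar set `A` and every measurable set of angles `Θ ⊆ ℝ` that contains each `θ ∈ (-π, π)` admitting
a radius `r` with `u_{μ-ε₁}(θ) < r < u_{μ+ε₁}(θ)` and `(r cos θ, r sin θ) ∈ A`:
`vol({k ∈ [-π,π)² : |ε(k) - μ| < ε₁} ∩ A) ≤ 16 L ε₁ · vol(Θ)`. -/
theorem klsb_volume_shell_inter_le {a' b' : ℝ} (ha' : -4 < a') (hb' : b' < 0) :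
    ∃ L : ℝ, 0 ≤ L ∧ ∀ (μ ε₁ : ℝ) (A : Set (ℝ × ℝ)) (Θ : Set ℝ), 0 < ε₁ →
      μ - ε₁ ∈ Icc a' b' → μ + ε₁ ∈ Icc a' b' → MeasurableSet A → MeasurableSet Θ →
      (∀ r θ : ℝ, θ ∈ Ioo (-π) π → bandFermiRadius (μ - ε₁) θ < r → r < bandFermiRadius (μ + ε₁) θ →
        ((r * Real.cos θ, r * Real.sin θ) : ℝ × ℝ) ∈ A → θ ∈ Θ) →
      volume ({x : ℝ × ℝ | (x.1 ∈ Ico (-π) π ∧ x.2 ∈ Ico (-π) π) ∧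
          |-2 * (Real.cos x.1 + Real.cos x.2) - μ| < ε₁} ∩ A) ≤
        ENNReal.ofReal (16 * L * ε₁) * volume Θ := by
  obtain ⟨L, hL0, hL⟩ := exists_bandFermiRadius_sub_le ha' hb'
  refine ⟨L, hL0, fun μ ε₁ A Θ hε₁ hμ1 hμ2 hAm hΘm hAΘ => ?_⟩
  have hband : ∀ ν ∈ Icc a' b', -4 < ν ∧ ν < 0 := fun ν hν => ⟨ha'.trans_le hν.1, hν.2.trans_lt hb'⟩
  have hμ : μ ∈ Icc a' b' := ⟨by linarith [hμ1.1], by linarith [hμ2.2]⟩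
  set E' : Set (ℝ × ℝ) := {x : ℝ × ℝ | (x.1 ∈ Ico (-π) π ∧ x.2 ∈ Ico (-π) π) ∧
      |-2 * (Real.cos x.1 + Real.cos x.2) - μ| < ε₁} ∩ A with hE'
  have hE'm : MeasurableSet E' := (measurableSet_planarShell μ ε₁).inter hAm
  set R₁ : ℝ → ℝ := fun θ => bandFermiRadius (μ - ε₁) θ with hR₁
  set R₂ : ℝ → ℝ := fun θ => bandFermiRadius (μ + ε₁) θ with hR₂
  have hR₁c : Continuous R₁ := continuous_bandFermiRadius (hband _ hμ1).1 (hband _ hμ1).2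
  have hR₂c : Continuous R₂ := continuous_bandFermiRadius (hband _ hμ2).1 (hband _ hμ2).2
  set Wset : Set (ℝ × ℝ) := {q : ℝ × ℝ | (R₁ q.2 < q.1 ∧ q.1 < R₂ q.2) ∧ q.2 ∈ Θ} with hWset
  have hWm : MeasurableSet Wset :=
    ((measurableSet_lt (hR₁c.measurable.comp measurable_snd) measurable_fst).inter
      (measurableSet_lt measurable_fst (hR₂c.measurable.comp measurable_snd))).inter
      (measurable_snd hΘm)
  set g : ℝ × ℝ → ℝ≥0∞ := fun q => ENNReal.ofReal 8 * Wset.indicator (fun _ => (1 : ℝ≥0∞)) q with hg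
  have hgm : Measurable g := (measurable_const.indicator hWm).const_mul _
  have hpolar : volume E' = ∫⁻ q in polarCoord.target,
      ENNReal.ofReal q.1 • E'.indicator (1 : ℝ × ℝ → ℝ≥0∞) (polarCoord.symm q) := by
    rw [lintegral_comp_polarCoord_symm (E'.indicator 1), lintegral_indicator_one hE'm]
  have hpt : ∀ q ∈ polarCoord.target,
      ENNReal.ofReal q.1 • E'.indicator (1 : ℝ × ℝ → ℝ≥0∞) (polarCoord.symm q) ≤ g q := by
    rintro ⟨r, θ⟩ hq
    simp only [polarCoord_target, mem_prod, mem_Ioi, mem_Ioo] at hq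
    by_cases hmem : polarCoord.symm (r, θ) ∈ E'
    · rw [indicator_of_mem hmem, Pi.one_apply, smul_eq_mul, mul_one]
      simp only [polarCoord_symm_apply] at hmem
      obtain ⟨⟨⟨hx, hy⟩, hε⟩, hA⟩ := hmem
      have hx' : |r * Real.cos θ| ≤ π := abs_le.2 ⟨hx.1, hx.2.le⟩
      have hy' : |r * Real.sin θ| ≤ π := abs_le.2 ⟨hy.1, hy.2.le⟩
      have hray : rayDispersion (θ, r) = -2 * (Real.cos (r * Real.cos θ) + Real.cos (r * Real.sin θ)) :=
        rayDispersion_eq (θ, r)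
      rw [← hray] at hε
      have hwin := bandFermiRadius_lt_of_polar_mem (hband _ hμ1).1 (hband _ hμ1).2 (hband _ hμ2).1
        (hband _ hμ2).2 hq.1 hx' hy' (by linarith [(abs_lt.1 hε).1]) (by linarith [(abs_lt.1 hε).2])
      have hr8 : r ≤ 8 := (polar_mem_square_bounds hq.1 hx' hy').2
      have hθΘ : θ ∈ Θ := hAΘ r θ hq.2 hwin.1 hwin.2 hA
      rw [hg]
      simp only
      rw [indicator_of_mem (show ((r, θ) : ℝ × ℝ) ∈ Wset from ⟨hwin, hθΘ⟩), mul_one]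
      exact ENNReal.ofReal_le_ofReal hr8
    · rw [indicator_of_notMem hmem, smul_zero]
      exact bot_le
  have hI : ∫⁻ q in polarCoord.target, g q ≤ ENNReal.ofReal (16 * L * ε₁) * volume Θ := by
    rw [polarCoord_target, show (volume : Measure (ℝ × ℝ)) = (volume : Measure ℝ).prod volume from rfl,
      ← Measure.prod_restrict, lintegral_prod_symm _ hgm.aemeasurable]
    have hinner : ∀ θ ∈ Ioo (-π) π, ∫⁻ r in Ioi (0 : ℝ), g (r, θ) ≤
        ENNReal.ofReal (8 * (L * (2 * ε₁))) * Θ.indicator 1 θ := by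
      intro θ hθ
      have hθ' : θ ∈ Icc (-π) π := Ioo_subset_Icc_self hθ
      have hdiff : R₂ θ - R₁ θ ≤ L * (2 * ε₁) := by
        have h := hL θ hθ' (μ - ε₁) hμ1 (μ + ε₁) hμ2 (by linarith)
        rw [show μ + ε₁ - (μ - ε₁) = 2 * ε₁ by ring] at h
        exact h
      by_cases hθΘ : θ ∈ Θ
      · have hgr : ∀ r, g (r, θ) = ENNReal.ofReal 8 * (Ioo (R₁ θ) (R₂ θ)).indicator 1 r := fun r => by
          simp only [hg, hWset, indicator, mem_setOf_eq, mem_Ioo, Pi.one_apply, hθΘ, and_true]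
        rw [indicator_of_mem hθΘ, Pi.one_apply, mul_one]
        calc ∫⁻ r in Ioi (0 : ℝ), g (r, θ)
            ≤ ∫⁻ r, g (r, θ) := lintegral_mono' Measure.restrict_le_self le_rfl
          _ = ENNReal.ofReal 8 * volume (Ioo (R₁ θ) (R₂ θ)) := by
              simp_rw [hgr]
              rw [lintegral_const_mul' _ _ ENNReal.ofReal_ne_top, lintegral_indicator_one measurableSet_Ioo]
          _ = ENNReal.ofReal 8 * ENNReal.ofReal (R₂ θ - R₁ θ) := by rw [Real.volume_Ioo]
          _ ≤ ENNReal.ofReal 8 * ENNReal.ofReal (L * (2 * ε₁)) := by gcongr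
          _ = ENNReal.ofReal (8 * (L * (2 * ε₁))) := (ENNReal.ofReal_mul (by norm_num)).symm
      · have hgr : ∀ r, g (r, θ) = 0 := fun r => by
          simp only [hg, hWset, indicator, mem_setOf_eq, hθΘ, and_false, if_false, mul_zero]
        simp_rw [hgr]
        rw [lintegral_zero]
        exact bot_le
    have hΘi : Measurable fun θ => ENNReal.ofReal (8 * (L * (2 * ε₁))) * Θ.indicator (1 : ℝ → ℝ≥0∞) θ :=
      (measurable_const.indicator hΘm).const_mul _
    calc ∫⁻ θ in Ioo (-π) π, ∫⁻ r in Ioi (0 : ℝ), g (r, θ)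
        ≤ ∫⁻ θ in Ioo (-π) π, ENNReal.ofReal (8 * (L * (2 * ε₁))) * Θ.indicator 1 θ :=
          setLIntegral_mono hΘi hinner
      _ ≤ ∫⁻ θ, ENNReal.ofReal (8 * (L * (2 * ε₁))) * Θ.indicator 1 θ :=
          lintegral_mono' Measure.restrict_le_self le_rfl
      _ = ENNReal.ofReal (8 * (L * (2 * ε₁))) * volume Θ := by
          rw [lintegral_const_mul' _ _ ENNReal.ofReal_ne_top, lintegral_indicator_one hΘm]
      _ = ENNReal.ofReal (16 * L * ε₁) * volume Θ := by
          congr 1; congr 1; ring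
  calc volume E' = ∫⁻ q in polarCoord.target,
        ENNReal.ofReal q.1 • E'.indicator (1 : ℝ × ℝ → ℝ≥0∞) (polarCoord.symm q) := hpolar
    _ ≤ ∫⁻ q in polarCoord.target, g q := setLIntegral_mono hgm hpt
    _ ≤ ENNReal.ofReal (16 * L * ε₁) * volume Θ := hI

section Main

variable {a b : ℝ} (B : BandBounds a b) {μ : ℝ} (hμ : μ ∈ Icc a b)
include B hμ

/-- **The angular measure of a ball on the curve.** The angles `θ ∈ (-π, π)` at which the curve
point `p_μ(θ)` lies in the sup-norm ball of radius `ρ` about `c`, `ρ/(√2 u_min) < 1`, have measure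
`≤ 3·2π·(2ρ)/(√2 u_min)` (all such angles are within `π·2ρ/(√2 u_min)` of any one of them modulo `2π`
by `chord_lower`; three representatives meet `(-π, π)`). -/
theorem klsb_volume_angularBall_le {c₁ c₂ ρ : ℝ} (hρ : ρ / (Real.sqrt 2 * B.umin) < 1) :
    volume {θ ∈ Ioo (-π) π | max |bandX μ θ - c₁| |bandY μ θ - c₂| ≤ ρ} ≤
      3 * ENNReal.ofReal (2 * (π * (2 * ρ / (Real.sqrt 2 * B.umin)))) := by
  classical
  have hπ := Real.pi_pos
  set W := π * (2 * ρ / (Real.sqrt 2 * B.umin)) with hW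
  set V := {θ ∈ Ioo (-π) π | max |bandX μ θ - c₁| |bandY μ θ - c₂| ≤ ρ} with hV
  by_cases hex : ∃ ζ, ζ ∈ V
  · obtain ⟨ζ, hζP, hζc⟩ := hex
    have hcover : V ⊆ Icc (ζ + (-1 : ℤ) * (2 * π) - W) (ζ + (-1 : ℤ) * (2 * π) + W) ∪
        Icc (ζ + (0 : ℤ) * (2 * π) - W) (ζ + (0 : ℤ) * (2 * π) + W) ∪
        Icc (ζ + (1 : ℤ) * (2 * π) - W) (ζ + (1 : ℤ) * (2 * π) + W) := by
      intro θ hθ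
      obtain ⟨hθP, hθc⟩ := hθ
      have hclose : max |bandX μ θ - bandX μ ζ| |bandY μ θ - bandY μ ζ| ≤ 2 * ρ := by
        obtain ⟨h1a, h1b⟩ := abs_le.1 ((le_max_left _ _).trans hθc)
        obtain ⟨h2a, h2b⟩ := abs_le.1 ((le_max_right _ _).trans hθc)
        obtain ⟨h3a, h3b⟩ := abs_le.1 ((le_max_left _ _).trans hζc)
        obtain ⟨h4a, h4b⟩ := abs_le.1 ((le_max_right _ _).trans hζc)
        refine max_le ?_ ?_ <;> (rw [abs_le]; constructor <;> linarith)
      obtain ⟨k, hk⟩ := klsd_exists_int_near_of_close B hμ hclose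
      have hWlt : W < 2 * π := by
        rw [hW]
        have : 2 * ρ / (Real.sqrt 2 * B.umin) < 2 := by
          rw [mul_div_assoc]; linarith
        nlinarith [hπ]
      have hzζ : |θ - ζ| ≤ 2 * π := by
        rw [abs_le]; constructor <;> linarith [hθP.1, hθP.2, hζP.1, hζP.2]
      have hkabs : |(k : ℝ)| < 2 := by
        have h3 : |(k : ℝ) * (2 * π)| ≤ |θ - ζ| + W := by
          have e : (k : ℝ) * (2 * π) = (θ - ζ) - (θ - ζ - k * (2 * π)) := by ring
          calc |(k : ℝ) * (2 * π)| = |(θ - ζ) - (θ - ζ - k * (2 * π))| := by rw [← e]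
            _ ≤ |θ - ζ| + |θ - ζ - k * (2 * π)| := abs_sub _ _
            _ ≤ |θ - ζ| + W := by linarith [hk]
        rw [abs_mul, abs_of_pos (by positivity : (0:ℝ) < 2 * π)] at h3
        have h4 : |(k : ℝ)| * (2 * π) < 2 * (2 * π) := by linarith
        exact lt_of_mul_lt_mul_right h4 (by positivity)
      have hk2 : -2 < k ∧ k < 2 := by
        rw [abs_lt] at hkabs
        exact ⟨by exact_mod_cast hkabs.1, by exact_mod_cast hkabs.2⟩
      have hθI : θ ∈ Icc (ζ + k * (2 * π) - W) (ζ + k * (2 * π) + W) := by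
        rw [abs_le] at hk; constructor <;> linarith [hk.1, hk.2]
      rcases hk2 with ⟨hk1, hk3⟩
      interval_cases k
      · exact Or.inl (Or.inl (by simpa using hθI))
      · exact Or.inl (Or.inr (by simpa using hθI))
      · exact Or.inr (by simpa using hθI)
    have hvol : ∀ k : ℤ, volume (Icc (ζ + k * (2 * π) - W) (ζ + k * (2 * π) + W)) = ENNReal.ofReal (2 * W) := by
      intro k; rw [Real.volume_Icc]; congr 1; ring
    calc volume V ≤ volume (Icc (ζ + (-1 : ℤ) * (2 * π) - W) (ζ + (-1 : ℤ) * (2 * π) + W) ∪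
          Icc (ζ + (0 : ℤ) * (2 * π) - W) (ζ + (0 : ℤ) * (2 * π) + W) ∪
          Icc (ζ + (1 : ℤ) * (2 * π) - W) (ζ + (1 : ℤ) * (2 * π) + W)) := measure_mono hcover
      _ ≤ volume (Icc (ζ + (-1 : ℤ) * (2 * π) - W) (ζ + (-1 : ℤ) * (2 * π) + W) ∪
          Icc (ζ + (0 : ℤ) * (2 * π) - W) (ζ + (0 : ℤ) * (2 * π) + W)) +
          volume (Icc (ζ + (1 : ℤ) * (2 * π) - W) (ζ + (1 : ℤ) * (2 * π) + W)) := measure_union_le _ _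
      _ ≤ (volume (Icc (ζ + (-1 : ℤ) * (2 * π) - W) (ζ + (-1 : ℤ) * (2 * π) + W)) +
          volume (Icc (ζ + (0 : ℤ) * (2 * π) - W) (ζ + (0 : ℤ) * (2 * π) + W))) +
          volume (Icc (ζ + (1 : ℤ) * (2 * π) - W) (ζ + (1 : ℤ) * (2 * π) + W)) := by
          gcongr; exact measure_union_le _ _
      _ = 3 * ENNReal.ofReal (2 * W) := by rw [hvol, hvol, hvol]; ring
  · have hV0 : V = ∅ := Set.eq_empty_iff_forall_notMem.2 fun z hz => hex ⟨z, hz⟩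
    rw [hV0, measure_empty]
    exact bot_le

end Main

/-- **The Cooper region of the shell (App. D U5′ input).** For a compact sub-band with uniform
constants `B : BandBounds a' b'`: the planar measure of the part of the energy shell
`{|ε(k) - μ| < ε₁}` of the cell lying in the sup-norm ball `{|k + p|_∞ ≤ ρ}` is at most
`16 L ε₁ · 3 · 2π·2(ρ + Lε₁)/(√2 u_min)` whenever `(ρ + Lε₁)/(√2 u_min) < 1` — relative measure
`O(ρ + ε₁)` on the shell, uniformly in `p`. -/
theorem klsb_volume_shellBall_le {a' b' : ℝ} (B : BandBounds a' b') :
    ∃ L : ℝ, 0 ≤ L ∧ ∀ (μ ε₁ p₁ p₂ ρ : ℝ), 0 < ε₁ → μ - ε₁ ∈ Icc a' b' → μ + ε₁ ∈ Icc a' b' →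
      (ρ + L * ε₁) / (Real.sqrt 2 * B.umin) < 1 →
      volume ({x : ℝ × ℝ | (x.1 ∈ Ico (-π) π ∧ x.2 ∈ Ico (-π) π) ∧
          |-2 * (Real.cos x.1 + Real.cos x.2) - μ| < ε₁} ∩
          {x : ℝ × ℝ | max |x.1 + p₁| |x.2 + p₂| ≤ ρ}) ≤
        ENNReal.ofReal (16 * L * ε₁) *
          (3 * ENNReal.ofReal (2 * (π * (2 * (ρ + L * ε₁) / (Real.sqrt 2 * B.umin))))) := by
  obtain ⟨L, hL0, hgen⟩ := klsb_volume_shell_inter_le B.ha B.hb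
  obtain ⟨L', hL'0, hL'⟩ := exists_bandFermiRadius_sub_le B.ha B.hb
  -- we use the SAME Lipschitz constant for the radial window as the general lemma; to keep one
  -- constant we take the maximum
  refine ⟨max L L', le_max_of_le_left hL0, fun μ ε₁ p₁ p₂ ρ hε₁ hμ1 hμ2 hsmall => ?_⟩
  have hμ : μ ∈ Icc a' b' := ⟨by linarith [hμ1.1], by linarith [hμ2.2]⟩
  set M := max L L' with hM
  have hLM : L ≤ M := le_max_left _ _
  have hL'M : L' ≤ M := le_max_right _ _
  set Θ := {θ ∈ Ioo (-π) π | max |bandX μ θ - (-p₁)| |bandY μ θ - (-p₂)| ≤ ρ + M * ε₁} with hΘ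
  have hX : Continuous (bandX μ) := continuous_iff_continuousAt.2 fun t =>
    (hasDerivAt_bandX (B.level hμ).1 (B.level hμ).2 t).continuousAt
  have hY : Continuous (bandY μ) := continuous_iff_continuousAt.2 fun t =>
    (hasDerivAt_bandY (B.level hμ).1 (B.level hμ).2 t).continuousAt
  have hΘm : MeasurableSet Θ := by
    have hc : Continuous fun θ => max |bandX μ θ - (-p₁)| |bandY μ θ - (-p₂)| := by fun_prop
    have : Θ = Ioo (-π) π ∩ {θ | max |bandX μ θ - (-p₁)| |bandY μ θ - (-p₂)| ≤ ρ + M * ε₁} := by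
      ext θ; simp only [hΘ, mem_setOf_eq, mem_inter_iff]
    rw [this]
    exact measurableSet_Ioo.inter (measurableSet_le hc.measurable measurable_const)
  have hAm : MeasurableSet {x : ℝ × ℝ | max |x.1 + p₁| |x.2 + p₂| ≤ ρ} := by
    have hc : Continuous fun x : ℝ × ℝ => max |x.1 + p₁| |x.2 + p₂| := by fun_prop
    exact measurableSet_le hc.measurable measurable_const
  have hAΘ : ∀ r θ : ℝ, θ ∈ Ioo (-π) π → bandFermiRadius (μ - ε₁) θ < r → r < bandFermiRadius (μ + ε₁) θ →
      ((r * Real.cos θ, r * Real.sin θ) : ℝ × ℝ) ∈ {x : ℝ × ℝ | max |x.1 + p₁| |x.2 + p₂| ≤ ρ} → θ ∈ Θ := by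
    intro r θ hθ hr1 hr2 hA
    have hθI : θ ∈ Icc (-π) π := Ioo_subset_Icc_self hθ
    have hup : bandFermiRadius (μ + ε₁) θ - bandFermiRadius μ θ ≤ L' * ε₁ := by
      have h := hL' θ hθI μ hμ (μ + ε₁) hμ2 (by linarith)
      rwa [show μ + ε₁ - μ = ε₁ by ring] at h
    have hdn : bandFermiRadius μ θ - bandFermiRadius (μ - ε₁) θ ≤ L' * ε₁ := by
      have h := hL' θ hθI (μ - ε₁) hμ1 μ hμ (by linarith)
      rwa [show μ - (μ - ε₁) = ε₁ by ring] at h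
    have hru : |r - bandFermiRadius μ θ| ≤ M * ε₁ := by
      have : L' * ε₁ ≤ M * ε₁ := mul_le_mul_of_nonneg_right hL'M hε₁.le
      rw [abs_le]; constructor <;> linarith
    have hΔx : |r * Real.cos θ - bandX μ θ| ≤ M * ε₁ := by
      rw [show r * Real.cos θ - bandX μ θ = (r - bandFermiRadius μ θ) * Real.cos θ by
        simp only [bandX]; ring, abs_mul]
      exact (mul_le_of_le_one_right (abs_nonneg _) (Real.abs_cos_le_one θ)).trans hru
    have hΔy : |r * Real.sin θ - bandY μ θ| ≤ M * ε₁ := by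
      rw [show r * Real.sin θ - bandY μ θ = (r - bandFermiRadius μ θ) * Real.sin θ by
        simp only [bandY]; ring, abs_mul]
      exact (mul_le_of_le_one_right (abs_nonneg _) (Real.abs_sin_le_one θ)).trans hru
    have hA' : max |r * Real.cos θ + p₁| |r * Real.sin θ + p₂| ≤ ρ := hA
    obtain ⟨hA1, hA2⟩ := max_le_iff.1 hA'
    refine ⟨hθ, ?_⟩
    obtain ⟨hx1, hx2⟩ := abs_le.1 hΔx
    obtain ⟨hy1, hy2⟩ := abs_le.1 hΔy
    obtain ⟨ha1, ha2⟩ := abs_le.1 hA1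
    obtain ⟨hb1, hb2⟩ := abs_le.1 hA2
    refine max_le ?_ ?_ <;> (rw [abs_le]; constructor <;> linarith)
  have hmain := hgen μ ε₁ {x : ℝ × ℝ | max |x.1 + p₁| |x.2 + p₂| ≤ ρ} Θ hε₁ hμ1 hμ2 hAm hΘm hAΘ
  have hsmall' : (ρ + M * ε₁) / (Real.sqrt 2 * B.umin) < 1 := hsmall
  have hang := klsb_volume_angularBall_le B hμ (c₁ := -p₁) (c₂ := -p₂) hsmall'
  calc _ ≤ ENNReal.ofReal (16 * L * ε₁) * volume Θ := hmain
    _ ≤ ENNReal.ofReal (16 * M * ε₁) * (3 * ENNReal.ofReal (2 * (π * (2 * (ρ + M * ε₁) / (Real.sqrt 2 * B.umin))))) := by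
        gcongr

end Summit.HubbardSuperconductivity.HubbardSuperconductivity.Theorems

end
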